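import Summits.QuantumFields.YangMills.Theorems.UnitScaleTiltHistoryTailOfExistenceMinimalOrbitV4
import Summits.QuantumFields.YangMills.Theorems.UnitScaleTiltMinimiserStabilityRegPrOfHalvingExistence
import Summits.QuantumFields.YangMills.Theses.UnitScaleTilt
import HarnessLib

/-!
# R3 (rung leaf `T3YM3TorusStatement.YM3TorusSU2`, route `UnitScaleTilt`) — THE TYPED DAG OF RECORD AS ONE KERNEL THEOREM OVER ITS THREE DISPLAYED INPUTS:
# `YM3TorusSU2` ⇐ ⟨19200 v10 `stub_existenceMinimalOrbit` (EX)⟩ ∧ ⟨20520 `FluctuationComparisonRegPrIntL` (crux text, by name)⟩ ∧ ⟨NODE O's Sel∕Xs v4 χ-data rows (O‴χₛ)⟩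

Width seat `ym-ust-19936-w3` (gen 20); ★★OWNER WORD 86 (3) «R3 TYPED DAG — PROVISIONAL OF RECORD: `YM3TorusSU2` ⟸ ✓`closes (h200)(h201)(hK2)` with h200 `MinimiserStabilityRegPr` ⟸ {H ✓p705908,
EX} (19200 registry v10) · h201 `FluctuationComparisonRegPrIntL` ⟸ {EXW, GAP♯, DET-REP-B, H4ᶜ, LFR♯ᶜ} (20520 registry, verbs #2∕#3 in flight — read here AS THE CRUX TEXT) · hK2
`HistoryTailL` ⟸ {EX, (O‴χₛ)} (19936, ✓p757865)».  This file is that DAG's kernel certificate, by name, nothing else: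
* §1 ★ `minimiserStabilityRegPr_of_existenceMinimalOrbit (hEX) : …Theses.UnitScaleTilt.MinimiserStabilityRegPr` — 19200's crux decl from its ONE open registered row EX (the
  halving leaf H = ✓`MinimiserStabilityRegPrStubHalvingStep.stub_halvingStep` discharged by name in ✓`AttainmentOfExistence.MinimiserStabilityRegPr_of_halvingStep_of_existence`).
* §2 ★★★ `ym3TorusSU2_of_existenceMinimalOrbit_regPrIntL_selXsV4DataRows (hEX) (h201) (hrows) : T3YM3TorusStatement.YM3TorusSU2` := the route's ✓`Theses.UnitScaleTilt.closes` fed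
  with §1, the 20520 crux text `h201`, and ✓`HistoryTailOfExistenceMinimalOrbit.historyTailL_of_existenceMinimalOrbit_selXsV4DataRows_allL hEX hrows` (✓p757865) — EX counted ONCE.
* §3 ★★ `ym3TorusSU2_of_existenceMinimalOrbit_regPrIntL_nestedDataRows_dL` — the same with (O⁗χ) NODE O's nested v4 rows (seam discharged from the `γ₀`-row; recorded twin).
HONEST: compositions of landed theorems — NO analysis; the three inputs EX, `FluctuationComparisonRegPrIntL`, (O‴χₛ) are DISPLAYED HYPOTHESES, each OPEN; nothing of
[Balaban1985Variational] Thm 1 ∕ Props 7–8, of [Balaban1985UV3] Sect. B–C ∕ Thm 2, or of King's (3.12) is proved here; the rung R3 = continuum SU(2) YM₃ on T³ is NOT proved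
— it is REDUCED by name to those three rows; and R3 is NOT d = 4, NOT infinite volume, NOT a mass gap, NOT the Clay problem.
-/

set_option autoImplicit false

noncomputable section

namespace Summit.QuantumFields.YangMills.Theorems.RungOfExistenceMinimalOrbit

open MeasureTheory Set
open scoped Matrix.Norms.L2Operator
open Literature.MathematicalPhysics.QuantumFieldTheory.Balaban1983to89
open Literature.MathematicalPhysics.QuantumFieldTheory.Balaban1983to89.T3ContinuumYM3Torus
open Literature.MathematicalPhysics.QuantumFieldTheory.Balaban1983to89.T3UnitLawDensityEML (ℰp)
open Literature.MathematicalPhysics.QuantumFieldTheory.Balaban1983to89.T3PrintedRegularMinimiser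
open Literature.MathematicalPhysics.QuantumFieldTheory.Balaban1983to89.T3PrintedMinimiserExistence
open Literature.MathematicalPhysics.QuantumFieldTheory.Balaban1983to89.T3ConstrainedMinimiser (fibre)
open Literature.MathematicalPhysics.QuantumFieldTheory.Balaban1983to89.T3LowerAlongMinimisersSplit (MinimisersIn8At)
open Literature.MathematicalPhysics.QuantumFieldTheory.Balaban1983to89.T3Thm1Carrier (famX Idx)
open Literature.MathematicalPhysics.QuantumFieldTheory.Balaban1983to89.ExpMeanLog (deltaSU)
open Literature.MathematicalPhysics.QuantumFieldTheory.Balaban1985CMP102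
open Literature.MathematicalPhysics.QuantumFieldTheory.Balaban1985CMP102.Setting
open Summit.QuantumFields.Balaban3D.Carriers
open Summit.QuantumFields.Balaban3D.Proofs.Primitives
open Summit.QuantumFields.Balaban3D.Proofs.Thresholds (Q0)
open B7Prop2Explicit (C0)
open Summit.QuantumFields.YangMills.Theorems.AttainmentOfExistence (MinimiserStabilityRegPr_of_halvingStep_of_existence)
open Summit.QuantumFields.YangMills.Theorems.MinimiserStabilityRegPrStubHalvingStep (stub_halvingStep)
open Summit.QuantumFields.YangMills.Theorems.HistoryTailOfExistenceMinimalOrbit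
  (historyTailL_of_existenceMinimalOrbit_selXsV4DataRows_allL historyTailL_of_existenceMinimalOrbit_nestedDataRows_dL)

/-! ## §1 19200's crux decl from its one open registered row EX -/

/-- ★ **`MinimiserStabilityRegPr` (stmt-QuantumFields-19200, the route's h200) FROM ITS ONE OPEN REGISTERED ROW EX** — ✓`AttainmentOfExistence.MinimiserStabilityRegPr_of_halvingStep_of_existence`
with its `hV2` binder discharged by the LANDED leaf ✓`MinimiserStabilityRegPrStubHalvingStep.stub_halvingStep` (p705908); `hEX` = `Cruxes/MinimiserStabilityRegPr/Lines/birth_v10.lean`'s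
`stub_existenceMinimalOrbit` VERBATIM.  CONDITIONAL on EX (Prop. 7's existence clause from a background, displayed — not proved).
[cite: Balaban1985Variational, Thm 1 (8) p.279, Prop. 7 p.299, Prop. 8 p.304] -/
theorem minimiserStabilityRegPr_of_existenceMinimalOrbit
    (hEX : ∀ (L : ℕ), 1 < L → ∀ (B₃ : ℝ), 4 < B₃ → ∃ a₁' O₁ : ℝ, 0 < a₁' ∧ 1 ≤ O₁ ∧
      ∀ (F : T3Family), F.L = L → ∀ (n K : ℕ) (hnK : n < K) (ε₁ : ℝ), 0 < ε₁ →
        ∀ V : GaugeField (F.P n) 0 (Matrix.specialUnitaryGroup (Fin 2) ℂ), PlaqSmall ε₁ V →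
          ∀ U₀ : GaugeField (F.P K) 0 (Matrix.specialUnitaryGroup (Fin 2) ℂ), RegPr F n K ((L : ℝ) ^ 3 * B₃ * ε₁) U₀ → U₀ ∈ fibre F ℰp n K hnK.le V →
            ε₁ ≤ a₁' → ∃ U ∈ regFibrePr F n K hnK.le (O₁ * (L : ℝ) ^ 3 * B₃ * ε₁) V,
              IsMinOn (fun W : GaugeField (F.P K) 0 (Matrix.specialUnitaryGroup (Fin 2) ℂ) => wilsonAction4 W)
                (regFibrePr F n K hnK.le (O₁ * (L : ℝ) ^ 3 * B₃ * ε₁) V) U) :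
    Summit.QuantumFields.YangMills.Theses.UnitScaleTilt.MinimiserStabilityRegPr :=
  MinimiserStabilityRegPr_of_halvingStep_of_existence stub_halvingStep hEX

/-! ## §2 The rung leaf from the three displayed inputs, by the route's `closes` -/

/-- ★★★ **THE R3 TYPED DAG OF RECORD AS ONE KERNEL THEOREM**: the rung leaf `T3YM3TorusStatement.YM3TorusSU2` (continuum SU(2) YM₃ on every three-torus, as the route reads it) from
EXACTLY three displayed inputs — 19200's row EX (once), 20520's crux text `FluctuationComparisonRegPrIntL` by name, and NODE O's Sel∕Xs v4 supplier rows `hrows` (the second binder of the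
L-R4 door, VERBATIM) — through the route's own ✓`Theses.UnitScaleTilt.closes (h200) (h201) (hK2)`: `h200 := §1 hEX`, `hK2 := historyTailL_of_existenceMinimalOrbit_selXsV4DataRows_allL hEX hrows`
(✓p757865).  CONDITIONAL — all three inputs are OPEN displayed hypotheses; nothing of them is proved here.
[cite: Balaban1985Variational, Thm 1 (8) p.279, Prop. 7 p.299, Prop. 8 p.304; Balaban1985UV3, (5) p.256, (47) p.267, (67)–(71) p.273 and Thm 2 p.272; King1986, (3.12) p.657] -/
theorem ym3TorusSU2_of_existenceMinimalOrbit_regPrIntL_selXsV4DataRows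
    (hEX : ∀ (L : ℕ), 1 < L → ∀ (B₃ : ℝ), 4 < B₃ → ∃ a₁' O₁ : ℝ, 0 < a₁' ∧ 1 ≤ O₁ ∧
      ∀ (F : T3Family), F.L = L → ∀ (n K : ℕ) (hnK : n < K) (ε₁ : ℝ), 0 < ε₁ →
        ∀ V : GaugeField (F.P n) 0 (Matrix.specialUnitaryGroup (Fin 2) ℂ), PlaqSmall ε₁ V →
          ∀ U₀ : GaugeField (F.P K) 0 (Matrix.specialUnitaryGroup (Fin 2) ℂ), RegPr F n K ((L : ℝ) ^ 3 * B₃ * ε₁) U₀ → U₀ ∈ fibre F ℰp n K hnK.le V →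
            ε₁ ≤ a₁' → ∃ U ∈ regFibrePr F n K hnK.le (O₁ * (L : ℝ) ^ 3 * B₃ * ε₁) V,
              IsMinOn (fun W : GaugeField (F.P K) 0 (Matrix.specialUnitaryGroup (Fin 2) ℂ) => wilsonAction4 W)
                (regFibrePr F n K hnK.le (O₁ * (L : ℝ) ^ 3 * B₃ * ε₁) V) U)
    (h201 : Summit.QuantumFields.YangMills.Theses.UnitScaleTilt.FluctuationComparisonRegPrIntL)
    (hrows : ∀ L : ℕ, Odd L → 1 < L → ∃ (B₀ A₀ A₁ : ℝ), 0 < A₀ ∧ 0 < A₁ ∧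
      ∀ (B a₀ a₁ : ℝ), B₀ ≤ B → 1 ≤ 2 * B → 0 < a₀ → a₀ ≤ A₀ → 0 < a₁ → a₁ ≤ A₁ → B * a₁ ≤ a₀ →
        (143 * ((((3 + 4 : ℕ) : ℝ)) ^ 2 / 4) ^ 2) * (2 * (B * a₁)) ≤ 1 / 3 →
        2 * (2 * (B * a₁)) ≤ 2 * deltaSU (Fin 2) / (((3 + 4) * L : ℕ) : ℝ) ^ 2 →
        Thm1GlobalMinAt L a₀ a₁ B →
        ∃ (b₁ p₁ : ℝ), ∀ (b₀ p₀ : ℝ), b₁ ≤ b₀ → p₁ ≤ p₀ →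
          ∃ 𝔠 : AlphaConsts L (suGroupModel 2).N, 𝔠.b₀ = b₀ ∧ 𝔠.p₀ = p₀ ∧ 𝔠.B₃ = B ∧
            4 * 𝔠.B₃ * (L : ℝ) ^ 2 * avgWindowFactor L ≤ 𝔠.C68 ∧
            Real.exp (𝔠.p₀ - 1) ≤ 3 * C0 3 * 𝔠.C68 * (𝔠.b₀ * Q0 𝔠.p₀) ∧
            (𝔠.b₀ * Q0 𝔠.p₀) * (2 * (L : ℝ) ^ 2 * avgWindowFactor L) ^ 2 ≤ 3 * C0 3 * 𝔠.C68 * a₁ ^ 2 ∧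
            ∀ (F : T3Family) (hF : F.L = L),
              (∀ (γ : ℝ) (hγ : 0 < γ) (hγ1 : γ ≤ (min (hF ▸ 𝔠).gamma0 1) ^ 2) (K : ℕ),
                AlphaInputsT3AC.SmallFactor71OfRecT3 F (hF ▸ 𝔠) γ hγ hγ1 K) ∧
              ∀ (γ : ℝ) (hγ : 0 < γ) (hγ1 : γ ≤ (min (hF ▸ 𝔠).gamma0 1) ^ 2) (K : ℕ),
                (∃ Ut : (k : ℕ) → GaugeField (F.P K) k (Matrix.specialUnitaryGroup (Fin 2) ℂ) →
                    GaugeField (F.P K) 0 (Matrix.specialUnitaryGroup (Fin 2) ℂ),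
                  AlphaInputsT3AC.TrivMinimiserRowsT3 F (hF ▸ 𝔠) γ hγ hγ1 a₀ a₁ K Ut) →
                ∃ Ut : (k : ℕ) → GaugeField (F.P K) k (Matrix.specialUnitaryGroup (Fin 2) ℂ) →
                    GaugeField (F.P K) 0 (Matrix.specialUnitaryGroup (Fin 2) ℂ),
                  AlphaInputsT3AC.TrivMinimiserRowsT3 F (hF ▸ 𝔠) γ hγ hγ1 a₀ a₁ K Ut ∧
                    AlphaInputsT3AC.DataRowsT3XsChiSel F (hF ▸ 𝔠) γ hγ hγ1 K Ut) :
    Literature.MathematicalPhysics.QuantumFieldTheory.Balaban1983to89.T3YM3TorusStatement.YM3TorusSU2 :=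
  Summit.QuantumFields.YangMills.Theses.UnitScaleTilt.closes (minimiserStabilityRegPr_of_existenceMinimalOrbit hEX) h201
    (historyTailL_of_existenceMinimalOrbit_selXsV4DataRows_allL hEX hrows)

/-! ## §3 The nested twin (recorded; Sel∕Xs is the display of record) -/

/-- ★★ **THE RUNG LEAF FROM EX, `FluctuationComparisonRegPrIntL` AND NODE O's NESTED v4 ROWS** (seam (71)_sym discharged from the numeral-free `γ₀`-row) — §2's twin over
✓`historyTailL_of_existenceMinimalOrbit_nestedDataRows_dL`.  CONDITIONAL; the nested display is true-but-vacuous at the vortex datum (BILL §8) — recorded for completeness.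
[cite: Balaban1985Variational, Thm 1 (8) p.279, Prop. 7 p.299, Prop. 8 p.304; Balaban1985UV3, (5) p.256, (7) p.257, (47) p.267, (67)–(71) p.273 and Thm 2 p.272; King1986, (3.12) p.657] -/
theorem ym3TorusSU2_of_existenceMinimalOrbit_regPrIntL_nestedDataRows_dL
    (hEX : ∀ (L : ℕ), 1 < L → ∀ (B₃ : ℝ), 4 < B₃ → ∃ a₁' O₁ : ℝ, 0 < a₁' ∧ 1 ≤ O₁ ∧
      ∀ (F : T3Family), F.L = L → ∀ (n K : ℕ) (hnK : n < K) (ε₁ : ℝ), 0 < ε₁ →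
        ∀ V : GaugeField (F.P n) 0 (Matrix.specialUnitaryGroup (Fin 2) ℂ), PlaqSmall ε₁ V →
          ∀ U₀ : GaugeField (F.P K) 0 (Matrix.specialUnitaryGroup (Fin 2) ℂ), RegPr F n K ((L : ℝ) ^ 3 * B₃ * ε₁) U₀ → U₀ ∈ fibre F ℰp n K hnK.le V →
            ε₁ ≤ a₁' → ∃ U ∈ regFibrePr F n K hnK.le (O₁ * (L : ℝ) ^ 3 * B₃ * ε₁) V,
              IsMinOn (fun W : GaugeField (F.P K) 0 (Matrix.specialUnitaryGroup (Fin 2) ℂ) => wilsonAction4 W)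
                (regFibrePr F n K hnK.le (O₁ * (L : ℝ) ^ 3 * B₃ * ε₁) V) U)
    (h201 : Summit.QuantumFields.YangMills.Theses.UnitScaleTilt.FluctuationComparisonRegPrIntL)
    (hrows : ∀ L : ℕ, Odd L → 1 < L → ∃ (B₀ A₀ A₁ : ℝ), 0 < A₀ ∧ 0 < A₁ ∧
      ∀ (B a₀ a₁ : ℝ), B₀ ≤ B → 1 ≤ 2 * B → 0 < a₀ → a₀ ≤ A₀ → 0 < a₁ → a₁ ≤ A₁ → B * a₁ ≤ a₀ →
        (143 * ((((3 + 4 : ℕ) : ℝ)) ^ 2 / 4) ^ 2) * (2 * (B * a₁)) ≤ 1 / 3 →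
        2 * (2 * (B * a₁)) ≤ 2 * deltaSU (Fin 2) / (((3 + 4) * L : ℕ) : ℝ) ^ 2 →
        Thm1GlobalMinAt L a₀ a₁ B →
        ∃ (b₁ p₁ : ℝ), ∀ (b₀ p₀ : ℝ), b₁ ≤ b₀ → p₁ ≤ p₀ → ∀ (φ : ℝ → ℝ), (∀ x : ℝ, 0 < x → 0 < φ x) →
          ∃ 𝔠 : AlphaConsts L (suGroupModel 2).N, 𝔠.b₀ = b₀ ∧ 𝔠.p₀ = p₀ ∧ 𝔠.B₃ = B ∧
            4 * 𝔠.B₃ * (L : ℝ) ^ 2 * avgWindowFactor L ≤ 𝔠.C68 ∧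
            Real.exp (𝔠.p₀ - 1) ≤ 3 * C0 3 * 𝔠.C68 * (𝔠.b₀ * Q0 𝔠.p₀) ∧
            (𝔠.b₀ * Q0 𝔠.p₀) * (2 * (L : ℝ) ^ 2 * avgWindowFactor L) ^ 2 ≤ 3 * C0 3 * 𝔠.C68 * a₁ ^ 2 ∧
            7 * L + 3 ≤ 𝔠.M₁ ∧
            𝔠.gamma0 ≤ ((φ 𝔠.C68 / (𝔠.b₀ * Q0 𝔠.p₀)) ^ 2) ^ 2 ∧
            ∀ (F : T3Family) (hF : F.L = L) (γ : ℝ) (hγ : 0 < γ) (hγ1 : γ ≤ (min (hF ▸ 𝔠).gamma0 1) ^ 2) (K : ℕ),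
              (∃ Ut : (k : ℕ) → GaugeField (F.P K) k (Matrix.specialUnitaryGroup (Fin 2) ℂ) →
                  GaugeField (F.P K) 0 (Matrix.specialUnitaryGroup (Fin 2) ℂ),
                AlphaInputsT3AC.TrivMinimiserRowsT3 F (hF ▸ 𝔠) γ hγ hγ1 a₀ a₁ K Ut) →
              ∃ Ut : (k : ℕ) → GaugeField (F.P K) k (Matrix.specialUnitaryGroup (Fin 2) ℂ) →
                  GaugeField (F.P K) 0 (Matrix.specialUnitaryGroup (Fin 2) ℂ),
                AlphaInputsT3AC.TrivMinimiserRowsT3 F (hF ▸ 𝔠) γ hγ hγ1 a₀ a₁ K Ut ∧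
                  AlphaInputsT3AC.DataRowsT3NestedChiSel F (hF ▸ 𝔠) γ hγ hγ1 K Ut) :
    Literature.MathematicalPhysics.QuantumFieldTheory.Balaban1983to89.T3YM3TorusStatement.YM3TorusSU2 :=
  Summit.QuantumFields.YangMills.Theses.UnitScaleTilt.closes (minimiserStabilityRegPr_of_existenceMinimalOrbit hEX) h201
    (historyTailL_of_existenceMinimalOrbit_nestedDataRows_dL hEX hrows)

end Summit.QuantumFields.YangMills.Theorems.RungOfExistenceMinimalOrbit

end
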